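import Literature.Combinatorics.Optimization.PerfectMatchingPolytopeDiameter
import Mathlib.Combinatorics.SimpleGraph.Diam
import HarnessLib

/-!
# The graph of the perfect matching polytope of `K_n` as a Mathlib `SimpleGraph`: connected, of diameter
# `2` for even `n ≥ 8` and complete for `n < 8` (PROVED)

This short file packages the kernel theorems of `PerfectMatchingPolytopeAdjacency.lean` (Chvátal 1975
Cor. 6.3 for perfect matchings [Chvatal1975, §6 Cor. 6.3 (p. 150)]: `χ^M, χ^N` adjacent iff `M △ N` is one
alternating circuit) and `PerfectMatchingPolytopeDiameter.lean` (any two perfect matchings are equal,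
adjacent or have a common neighbour; a non-adjacent pair exists iff `n ≥ 8`) in Mathlib's graph-metric
vocabulary (`SimpleGraph.edist`, `SimpleGraph.ediam`, `SimpleGraph.diam`), so that the 1-skeleton of the
cell's polytope can be quoted as ONE object:

* `pmSkeleton n : SimpleGraph (PMatch n)` — adjacency = Chvátal's neighbour relation `IsNeighbor`
  (= the segment `[χ^M, χ^N]` is an exposed edge of `conv{χ^P}`, `pmSkeleton_adj_iff_isExposed`;
  = `M △ N` one circuit, `pmSkeleton_adj_iff_symmDiffConnected`);
* `preconnected_pmSkeleton`, `connected_pmSkeleton` (even `n`), `edist_pmSkeleton_le_two`,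
  **`ediam_pmSkeleton_le_two`**, **`diam_pmSkeleton_le_two`**;
* **`diam_pmSkeleton_eq_two`**: for even `n ≥ 8` the diameter is exactly `2` (`ediam_pmSkeleton_eq_two`);
* **`pmSkeleton_eq_top_of_lt_eight`**: for `n < 8` the skeleton is the complete graph.

Source status as in the parent files: the adjacency criterion is Chvátal's (held); the diameter statement
is attributed by section title to [Schrijver2003, Vol. A §25.5a "Adjacency and diameter of the matching
polytope" (p. 444)] (text not held; Padberg–Rao 1974 paywalled, acq-14672) and is proved independently in
the parent file. Label: catalogue / instrument; no bearing on `rank_psd` or the crux; no P-vs-NP content.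
-/

noncomputable section

namespace Literature.Combinatorics.Optimization

open Literature.Barriers.PneNP

namespace PMPolytopeDim

variable {n : ℕ}

/-- **The graph (1-skeleton) of the perfect matching polytope of `K_n`**: vertices the perfect matchings,
adjacency Chvátal's neighbour relation. [cite: Chvatal1975, §6 (p. 149)] [cite: Schrijver2003, Vol. A §25.5a (p. 444)] -/
def pmSkeleton (n : ℕ) : SimpleGraph (PMatch n) := SimpleGraph.fromRel (IsNeighbor (n := n))

/-- Adjacency in the skeleton is the neighbour relation. [cite: Chvatal1975, §6 (p. 149)] -/
theorem pmSkeleton_adj {M N : PMatch n} : (pmSkeleton n).Adj M N ↔ IsNeighbor M N := by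
  rw [pmSkeleton, SimpleGraph.fromRel_adj]
  exact ⟨fun ⟨_, h⟩ => h.elim id IsNeighbor.symm, fun h => ⟨h.1, Or.inl h⟩⟩

/-- Adjacency iff `M △ N` defines a connected graph (one alternating circuit). [cite: Chvatal1975, §6 Cor. 6.3 (p. 150)] -/
theorem pmSkeleton_adj_iff_symmDiffConnected {M N : PMatch n} :
    (pmSkeleton n).Adj M N ↔ SymmDiffConnected M N :=
  pmSkeleton_adj.trans Chvatal1975_cor63_perfectMatching

/-- Adjacency iff the segment `[χ^M, χ^N]` (`M ≠ N`) is an exposed face of `conv{χ^P}`.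
[cite: Chvatal1975, §6 (p. 149)] -/
theorem pmSkeleton_adj_iff_isExposed {M N : PMatch n} :
    (pmSkeleton n).Adj M N ↔ M ≠ N ∧
      IsExposed ℝ (convexHull ℝ (Set.range (pmVec n))) (segment ℝ (pmVec n M) (pmVec n N)) :=
  pmSkeleton_adj.trans isNeighbor_iff_isExposed_segment

/-- Between any two vertices there is a walk of length at most two. [cite: Schrijver2003, Vol. A §25.5a (p. 444)] -/
theorem exists_walk_pmSkeleton_length_le_two (M N : PMatch n) :
    ∃ p : (pmSkeleton n).Walk M N, p.length ≤ 2 := by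
  rcases pmPolytope_diameter_le_two M N with rfl | h | ⟨P, hM, hN⟩
  · exact ⟨SimpleGraph.Walk.nil, by simp⟩
  · exact ⟨SimpleGraph.Walk.cons (pmSkeleton_adj.2 h) SimpleGraph.Walk.nil, by simp⟩
  · exact ⟨SimpleGraph.Walk.cons (pmSkeleton_adj.2 hM)
      (SimpleGraph.Walk.cons (pmSkeleton_adj.2 hN.symm) SimpleGraph.Walk.nil), by simp⟩

/-- Any two vertices of the skeleton are reachable from each other. [cite: Schrijver2003, Vol. A §25.5a (p. 444)] -/
theorem reachable_pmSkeleton (M N : PMatch n) : (pmSkeleton n).Reachable M N := by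
  obtain ⟨p, -⟩ := exists_walk_pmSkeleton_length_le_two M N
  exact ⟨p⟩

/-- The skeleton is preconnected (for odd `n` it has no vertices). [cite: Schrijver2003, Vol. A §25.5a (p. 444)] -/
theorem preconnected_pmSkeleton (n : ℕ) : (pmSkeleton n).Preconnected :=
  fun M N => reachable_pmSkeleton M N

/-- `K_n` has a perfect matching iff `n` is even; for even `n` the vertex type is nonempty.
[cite: Edmonds1965, §2 Thm. (P) (p. 126), perfect-matching form] -/
theorem nonempty_PMatch (hn : Even n) : Nonempty (PMatch n) := by
  obtain ⟨M, hM⟩ := exists_isPMOn_of_even n (Finset.univ : Finset (Fin n)) (by simp) hn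
  exact ⟨⟨M, hM⟩⟩

/-- For even `n` the skeleton is connected. [cite: Schrijver2003, Vol. A §25.5a (p. 444)] -/
theorem connected_pmSkeleton (hn : Even n) : (pmSkeleton n).Connected :=
  (SimpleGraph.connected_iff _).2 ⟨preconnected_pmSkeleton n, nonempty_PMatch hn⟩

/-- Every distance in the skeleton is at most `2`. [cite: Schrijver2003, Vol. A §25.5a (p. 444)] -/
theorem edist_pmSkeleton_le_two (M N : PMatch n) : (pmSkeleton n).edist M N ≤ 2 := by
  obtain ⟨p, hp⟩ := exists_walk_pmSkeleton_length_le_two M N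
  exact (SimpleGraph.Walk.edist_le p).trans (by exact_mod_cast hp)

/-- **The (extended) diameter of the skeleton of `P_PM(K_n)` is at most `2`.** [cite: Schrijver2003, Vol. A §25.5a (p. 444)] -/
theorem ediam_pmSkeleton_le_two (n : ℕ) : (pmSkeleton n).ediam ≤ 2 :=
  SimpleGraph.ediam_le_iff.2 fun M N => edist_pmSkeleton_le_two M N

/-- **`diam ≤ 2`.** [cite: Schrijver2003, Vol. A §25.5a (p. 444)] -/
theorem diam_pmSkeleton_le_two (n : ℕ) : (pmSkeleton n).diam ≤ 2 := by
  rw [SimpleGraph.diam]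
  exact ENat.toNat_le_of_le_coe (ediam_pmSkeleton_le_two n)

/-- An extended natural number other than `0` and `1` is at least `2`. [folklore] -/
private theorem two_le_of_ne_zero_of_ne_one {m : ℕ∞} (h0 : m ≠ 0) (h1 : m ≠ 1) : 2 ≤ m := by
  induction m using ENat.recTopCoe with
  | top => exact le_top
  | coe k =>
    have hk : 2 ≤ k := by
      by_contra h
      push Not at h
      interval_cases k
      · exact h0 rfl
      · exact h1 rfl
    exact_mod_cast hk

/-- Two distinct non-adjacent vertices are at distance exactly `2`. [cite: Schrijver2003, Vol. A §25.5a (p. 444)] -/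
theorem edist_pmSkeleton_eq_two {M N : PMatch n} (hne : M ≠ N) (h : ¬IsNeighbor M N) :
    (pmSkeleton n).edist M N = 2 := by
  refine le_antisymm (edist_pmSkeleton_le_two M N) (two_le_of_ne_zero_of_ne_one ?_ ?_)
  · rw [Ne, SimpleGraph.edist_eq_zero_iff]; exact hne
  · rw [Ne, SimpleGraph.edist_eq_one_iff_adj, pmSkeleton_adj]; exact h

/-- **For even `n ≥ 8` the skeleton of `P_PM(K_n)` has (extended) diameter exactly `2`.**
[cite: Schrijver2003, Vol. A §25.5a (p. 444)] -/
theorem ediam_pmSkeleton_eq_two (hn : Even n) (h8 : 8 ≤ n) : (pmSkeleton n).ediam = 2 := by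
  refine le_antisymm (ediam_pmSkeleton_le_two n) ?_
  obtain ⟨M⟩ := nonempty_PMatch hn
  obtain ⟨N, hNM, hnot⟩ := exists_not_isNeighbor h8 M
  rw [← edist_pmSkeleton_eq_two (Ne.symm hNM) hnot]
  exact SimpleGraph.edist_le_ediam

/-- **For even `n ≥ 8`, `diam (pmSkeleton n) = 2`.** [cite: Schrijver2003, Vol. A §25.5a (p. 444)] -/
theorem diam_pmSkeleton_eq_two (hn : Even n) (h8 : 8 ≤ n) : (pmSkeleton n).diam = 2 := by
  rw [SimpleGraph.diam, ediam_pmSkeleton_eq_two hn h8]; rfl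

/-- **For `n < 8` the skeleton is complete** (`P_PM(K_4)`: a triangle; `P_PM(K_6)`: `K_15`).
[cite: Schrijver2003, Vol. A §25.5a (p. 444)] -/
theorem pmSkeleton_eq_top_of_lt_eight (hn : n < 8) : pmSkeleton n = ⊤ := by
  ext M N
  rw [SimpleGraph.top_adj, pmSkeleton_adj]
  exact ⟨fun h => h.1, fun h => isNeighbor_of_lt_eight hn h⟩

/-- Small even `n`: for `n < 8` every distance between distinct vertices is `1`, so the extended
diameter is at most `1`. [cite: Schrijver2003, Vol. A §25.5a (p. 444)] -/
theorem ediam_pmSkeleton_le_one_of_lt_eight (hn : n < 8) : (pmSkeleton n).ediam ≤ 1 := by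
  refine SimpleGraph.ediam_le_iff.2 fun M N => ?_
  by_cases h : M = N
  · subst h; rw [(SimpleGraph.edist_eq_zero_iff).2 rfl]; exact bot_le
  · rw [(SimpleGraph.edist_eq_one_iff_adj).2 (pmSkeleton_adj.2 (isNeighbor_of_lt_eight hn h))]

end PMPolytopeDim

end Literature.Combinatorics.Optimization
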